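import Mathlib.Analysis.SpecialFunctions.Pow.Real
import Mathlib.Analysis.SpecialFunctions.Sqrt
import HarnessLib

/-!
# Exact rounding of `x/√D` with integer arithmetic

Topic `Analysis/SpecialFunctions` (elementary). A machine that must output the nearest integer to
`x/√D` for integers `x` and `D ≥ 1` — e.g. the `b`-bit rounding `round(2ᵇ u)` of an entry
`u = β/√(d d')` of an exactly orthonormalised integer matrix (integral Gram–Schmidt, Cohen 1993,
§2.6.3: `b*ₖ = (dₖ b*ₖ)/dₖ`, `‖b*ₖ‖² = dₖ₊₁/dₖ`), as in the reduction machine of the discharge of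
Aaronson–Arkhipov's Thm. 1.3
(`Literature.Computability.QuantumComplexity.gpeSolvableInFBPPRel_NPRel_of_approxBosonSamplingOracle`)
— can do so with natural-number division and integer square roots only:

* `natSqrt_div_eq_floor` — `⌊√(a/D)⌋ = Nat.sqrt (a / D)` (integer division inside);
* `ceilSqrtDiv a D = ⌈√(a/D)⌉` (`ceilSqrtDiv_eq_ceil`), computed as `Nat.sqrt (t - 1) + 1` with
  `t = ⌈a/D⌉ = (a + D - 1)/D` (and `0` when `t = 0`);
* `floorTwoMulDivSqrt x D = ⌊2x/√D⌋` (`floorTwoMulDivSqrt_eq_floor`), by cases on the sign of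
  `x` (`2|x|/√D = √(4x²/D)`);
* **`roundDivSqrt_eq_round`** — `roundDivSqrt x D = round (x/√D)` where
  `roundDivSqrt x D = (⌊2x/√D⌋ + 1) / 2` (floor division), from `round y = ⌊y + ½⌋` and
  `⌊(y + 1)/2⌋ = ⌊(⌊y⌋ + 1)/2⌋` (`floor_add_one_div_two`).

All proved, Mathlib only.

## References

* H. Cohen, *A Course in Computational Algebraic Number Theory*, GTM 138, Springer 1993, §2.6.3
  (integral Gram–Schmidt) and Algorithm 1.7.1 (integer square root).
-/

namespace Literature.Analysis.SpecialFunctions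

open Real

/-! ### Floor and ceiling of `√(a/D)` -/

/-- **`⌊√(a/D)⌋ = Nat.sqrt (a / D)`** for naturals `a` and `D ≥ 1` (the inner division may be
taken in `ℕ`: `⌊√t⌋ = ⌊√⌊t⌋⌋`). [folklore] -/
theorem natSqrt_div_eq_floor (a : ℕ) {D : ℕ} (hD : 0 < D) :
    (Nat.sqrt (a / D) : ℤ) = ⌊√((a : ℝ) / D)⌋ := by
  have hDr : (0 : ℝ) < D := by exact_mod_cast hD
  set s := Nat.sqrt (a / D) with hs
  symm
  rw [Int.floor_eq_iff]
  constructor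
  · -- `s ≤ √(a/D)` from `s² ≤ a/D`
    have h1 : s ^ 2 ≤ a / D := Nat.sqrt_le' (a / D)
    have h2 : ((s ^ 2 : ℕ) : ℝ) ≤ (a : ℝ) / D :=
      le_trans (by exact_mod_cast h1) (Nat.cast_div_le)
    push_cast at h2 ⊢
    rw [Real.le_sqrt (by positivity) (by positivity)]
    exact h2
  · -- `√(a/D) < s + 1` from `a/D < (s+1)²`
    have h1 : a / D < (s + 1) ^ 2 := Nat.lt_succ_sqrt' (a / D)
    have h2 : a < (a / D + 1) * D := by
      rw [add_mul, one_mul]; exact Nat.lt_div_mul_add hD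
    have h3 : a < (s + 1) ^ 2 * D := lt_of_lt_of_le h2 (Nat.mul_le_mul_right _ h1)
    have h4 : (a : ℝ) / D < ((s : ℝ) + 1) ^ 2 := by
      rw [div_lt_iff₀ hDr]; exact_mod_cast h3
    push_cast
    calc √((a : ℝ) / D) < √(((s : ℝ) + 1) ^ 2) := Real.sqrt_lt_sqrt (by positivity) h4
      _ = (s : ℝ) + 1 := Real.sqrt_sq (by positivity)

/-- `⌈√(a/D)⌉` with natural-number arithmetic: with `t = ⌈a/D⌉ = (a + D - 1)/D`, it is `0` if
`t = 0` and `Nat.sqrt (t - 1) + 1` otherwise. [folklore] -/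
def ceilSqrtDiv (a D : ℕ) : ℕ :=
  if (a + D - 1) / D = 0 then 0 else Nat.sqrt ((a + D - 1) / D - 1) + 1

/-- **`ceilSqrtDiv a D = ⌈√(a/D)⌉`** for `D ≥ 1`. [folklore] -/
theorem ceilSqrtDiv_eq_ceil (a : ℕ) {D : ℕ} (hD : 0 < D) :
    (ceilSqrtDiv a D : ℤ) = ⌈√((a : ℝ) / D)⌉ := by
  have hDr : (0 : ℝ) < D := by exact_mod_cast hD
  unfold ceilSqrtDiv
  set t := (a + D - 1) / D with ht
  -- `a ≤ t D` and `(t - 1) D ≤ a - 1`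
  have htD : a ≤ t * D := by
    rw [ht]
    have h2 : (a + D - 1) % D < D := Nat.mod_lt _ hD
    have h3 := Nat.div_add_mod (a + D - 1) D
    rw [mul_comm] at h3
    omega
  split_ifs with h0
  · -- `t = 0` forces `a = 0`
    have ha : a = 0 := by
      have : a ≤ 0 * D := h0 ▸ htD
      omega
    subst ha
    symm
    rw [Int.ceil_eq_iff]
    simp
  · have ht1 : 1 ≤ t := Nat.one_le_iff_ne_zero.2 h0
    have ha1 : 1 ≤ a := by
      by_contra h
      push Not at h
      have : a = 0 := by omega
      rw [this] at ht
      have : t = 0 := by rw [ht]; exact Nat.div_eq_of_lt (by omega)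
      exact h0 this
    set s := Nat.sqrt (t - 1) with hs
    -- `s² ≤ t - 1 < (s+1)²`
    have hs1 : s ^ 2 ≤ t - 1 := Nat.sqrt_le' _
    have hs2 : t - 1 < (s + 1) ^ 2 := Nat.lt_succ_sqrt' _
    have hlow : s ^ 2 * D < a := by
      have h1 : s ^ 2 * D ≤ (t - 1) * D := Nat.mul_le_mul_right _ hs1
      have h2 : (t - 1) * D ≤ a - 1 := by
        have := Nat.div_mul_le_self (a + D - 1) D
        rw [← ht] at this
        have h3 : (t - 1) * D = t * D - D := Nat.sub_one_mul t D
        omega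
      omega
    have hup : a ≤ (s + 1) ^ 2 * D :=
      htD.trans (Nat.mul_le_mul_right _ (by omega))
    symm
    rw [Int.ceil_eq_iff]
    push_cast
    constructor
    · -- `s < √(a/D)`
      rw [add_sub_cancel_right, Real.lt_sqrt (by positivity), lt_div_iff₀ hDr]
      exact_mod_cast hlow
    · -- `√(a/D) ≤ s + 1`
      rw [Real.sqrt_le_left (by positivity), div_le_iff₀ hDr]
      exact_mod_cast hup

/-! ### `⌊2x/√D⌋` and the rounding -/

/-- `⌊2x/√D⌋` with integer arithmetic (`2|x|/√D = √(4x²/D)`; floor for `x ≥ 0`, minus the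
ceiling for `x < 0`). [folklore] -/
def floorTwoMulDivSqrt (x : ℤ) (D : ℕ) : ℤ :=
  if 0 ≤ x then (Nat.sqrt (4 * x.natAbs ^ 2 / D) : ℤ) else -(ceilSqrtDiv (4 * x.natAbs ^ 2) D : ℤ)

/-- `2|x|/√D = √(4x²/D)`. [folklore] -/
theorem two_mul_natAbs_div_sqrt (x : ℤ) {D : ℕ} (hD : 0 < D) :
    2 * (x.natAbs : ℝ) / √D = √(((4 * x.natAbs ^ 2 : ℕ) : ℝ) / D) := by
  have hDr : (0 : ℝ) < D := by exact_mod_cast hD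
  have h4 : (((4 * x.natAbs ^ 2 : ℕ) : ℝ)) = (2 * (x.natAbs : ℝ)) ^ 2 := by push_cast; ring
  rw [h4, Real.sqrt_div' _ hDr.le, Real.sqrt_sq (by positivity)]

/-- **`floorTwoMulDivSqrt x D = ⌊2x/√D⌋`** for `D ≥ 1`. [folklore] -/
theorem floorTwoMulDivSqrt_eq_floor (x : ℤ) {D : ℕ} (hD : 0 < D) :
    floorTwoMulDivSqrt x D = ⌊2 * (x : ℝ) / √D⌋ := by
  unfold floorTwoMulDivSqrt
  split_ifs with hx
  · rw [natSqrt_div_eq_floor _ hD, ← two_mul_natAbs_div_sqrt x hD]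
    congr 2
    rw [Nat.cast_natAbs, Int.cast_abs, abs_of_nonneg (by exact_mod_cast hx)]
  · push Not at hx
    rw [ceilSqrtDiv_eq_ceil _ hD, ← two_mul_natAbs_div_sqrt x hD, ← Int.floor_neg]
    congr 1
    rw [Nat.cast_natAbs, Int.cast_abs, abs_of_neg (by exact_mod_cast hx)]
    ring

/-- `⌊(y + 1)/2⌋ = (⌊y⌋ + 1) / 2` (floor division by `2`). [folklore] -/
theorem floor_add_one_div_two (y : ℝ) : ⌊(y + 1) / 2⌋ = (⌊y⌋ + 1) / 2 := by
  set F := ⌊y⌋ with hF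
  have h1 : (F : ℝ) ≤ y := Int.floor_le y
  have h2 : y < F + 1 := Int.lt_floor_add_one y
  rw [Int.floor_eq_iff]
  set qq := (F + 1) / 2 with hq
  set rr := (F + 1) % 2 with hr
  have hdm : F + 1 = 2 * qq + rr := by omega
  have hcast : ((F : ℝ) + 1) = 2 * (qq : ℝ) + (rr : ℝ) := by exact_mod_cast hdm
  have hr0' : (0 : ℝ) ≤ rr := by exact_mod_cast (by omega : (0 : ℤ) ≤ rr)
  have hr1' : (rr : ℝ) ≤ 1 := by exact_mod_cast (by omega : rr ≤ 1)
  constructor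
  · rw [le_div_iff₀ (by norm_num : (0:ℝ) < 2)]; linarith
  · rw [div_lt_iff₀ (by norm_num : (0:ℝ) < 2)]; linarith

/-- `round (x/√D)` with integer arithmetic: `(⌊2x/√D⌋ + 1) / 2` (floor division). [folklore] -/
def roundDivSqrt (x : ℤ) (D : ℕ) : ℤ := (floorTwoMulDivSqrt x D + 1) / 2

/-- **Exact rounding: `roundDivSqrt x D = round (x/√D)`** for `D ≥ 1` (Mathlib's
`round y = ⌊y + ½⌋`). [folklore] -/
theorem roundDivSqrt_eq_round (x : ℤ) {D : ℕ} (hD : 0 < D) :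
    roundDivSqrt x D = round ((x : ℝ) / √D) := by
  rw [roundDivSqrt, floorTwoMulDivSqrt_eq_floor x hD, round_eq, ← floor_add_one_div_two]
  congr 1
  ring

/-- The rounding of a scaled quotient: `round (2ᵇ x / √D) = roundDivSqrt (2ᵇ x) D`, the form in
which a `b`-bit rounding of `x/√D` is computed. [folklore] -/
theorem round_two_pow_mul_div_sqrt (b : ℕ) (x : ℤ) {D : ℕ} (hD : 0 < D) :
    round ((2 : ℝ) ^ b * ((x : ℝ) / √D)) = roundDivSqrt (2 ^ b * x) D := by
  rw [roundDivSqrt_eq_round _ hD]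
  congr 1
  push_cast
  ring

end Literature.Analysis.SpecialFunctions
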